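import Mathlib.MeasureTheory.Integral.IntervalIntegral.IntegrationByParts
import Mathlib.MeasureTheory.Integral.IntervalIntegral.FundThmCalculus
import Mathlib.MeasureTheory.Integral.Bochner.ContinuousLinearMap
import Mathlib.Analysis.Calculus.ContDiff.Deriv
import Summits.QuantumFields.YangMills.Theorems.BalabanUVNodesN19TriangleWaveBessel

/-!
# N19 (NE7, s3 ALTERNATIVE CURRENCY) — The arcsine road: uniform monomial closeness by exact orthogonality

Module 95 of the `dag-n19-e` lineage (uniform-moment currency, fixed observables; CURRENCY-MAP v3 item
(w′)): the LAW SEQUENCE device of the negative answer to (w′).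

THE ARCSINE LAWS.  For a level `m ≥ 1` and an amplitude `|s| ≤ 1` let `Λ_{m,s}` be the law of `cos φ∕2`
when `φ ∈ [0,π]` is distributed with density `(1 + s·cos(mφ))∕π` (§2 ★ `exists_arcsineLaws`: probability
laws on `[−½,½] ⊆ [−1,1]` with `∫G dΛ_{m,s} = (1∕π)∫_0^π G(cos φ∕2)(1 + s cos(mφ))dφ`).  Then
* the MONOMIAL moments move, uniformly in the order, by at most `|s|·2^{−m}`:
  `∫x^j dΛ_{m,s} − ∫x^j dΛ_{m,0} = (s∕π)(½)^j ∫_0^π cos^jφ cos(mφ)dφ`, which VANISHES for `j < m` (§1,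
  `2cos(mφ)cos φ = cos((m−1)φ) + cos((m+1)φ)`, induction on `j`) and is `≤ |s|(½)^j` for `j ≥ m`
  (★ `abs_moment_sub_le`);
* a continuous observable `G` is paid `(s∕π)∫_0^π G(cos φ∕2)cos(mφ)dφ` (`integral_sub_eq`), and the C¹
  observable `G_f(x) = ∫_0^x f(arccos 2y)dy` (§3: derivative `f(arccos 2x)`, `|G_f′| ≤ B`, `B`-Lipschitz,
  `|G_f| ≤ B|x|`) is paid EXACTLY through two cosine coefficients of `f`:
  ★ `integral_obsOf_comp_mul_cos`: `∫_0^π G_f(cos φ∕2)cos((m+1)φ)dφ = (c_m(f) − c_{m+2}(f))∕(4(m+1))`,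
  `c_ν(f) = ∫_0^π f cos(ν·)` (integration by parts + `2 sin((m+1)φ) sin φ = cos(mφ) − cos((m+2)φ)`).
Module 96 runs these laws along a lacunary schedule against the function `f` of module 94.

HONEST FRAMING: [folklore] calculus ∕ measure bookkeeping over Mathlib and module 85 BY NAME; TOY laws;
no consumer in the DAG today; nothing of Bałaban's is instantiated; NE7 is NOT PRINTED and NOT proved
here; N19 is NOT discharged; count-neutral.  One finite 𝕋⁴ programme at fixed ε; nothing continuum ∕
OS ∕ mass-gap ∕ Clay.
-/

open Real MeasureTheory

namespace Summit.QuantumFields.YangMills.Theorems.BalabanUVNodesN19ArcsineRoad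

/-! ## §1 `cos^j ⊥ cos(m·)` on `[0,π]` for `j < m` [folklore] -/

/-- `∫_0^π cos^j(φ)cos(mφ)dφ = 0` for naturals `j < m`. [folklore] -/
theorem integral_cos_pow_mul_cos_eq_zero {j m : ℕ} (h : j < m) :
    ∫ φ in (0 : ℝ)..π, Real.cos φ ^ j * Real.cos (m * φ) = 0 := by
  induction j generalizing m with
  | zero =>
    have hm : m ≠ 0 := by omega
    have := BalabanUVNodesN19TriangleWaveBessel.integral_cos_nat_mul_cos_nat_mul_of_ne hm
    simpa using this
  | succ j ih =>
    have hm1 : 1 ≤ m := by omega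
    have e : ∀ φ : ℝ, Real.cos φ ^ (j + 1) * Real.cos (m * φ) =
        (1 / 2 : ℝ) * (Real.cos φ ^ j * Real.cos (((m - 1 : ℕ) : ℝ) * φ)) +
          (1 / 2 : ℝ) * (Real.cos φ ^ j * Real.cos (((m + 1 : ℕ) : ℝ) * φ)) := by
      intro φ
      have h2 := Real.two_mul_cos_mul_cos (m * φ) φ
      have e1 : ((m - 1 : ℕ) : ℝ) * φ = m * φ - φ := by rw [Nat.cast_sub hm1]; push_cast; ring
      have e2 : ((m + 1 : ℕ) : ℝ) * φ = m * φ + φ := by push_cast; ring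
      rw [e1, e2, pow_succ]
      linear_combination (1 / 2 : ℝ) * Real.cos φ ^ j * h2
    have hc : ∀ n : ℕ, Continuous fun φ : ℝ => Real.cos φ ^ j * Real.cos ((n : ℝ) * φ) := fun n =>
      (Real.continuous_cos.pow j).mul (Real.continuous_cos.comp (continuous_const.mul continuous_id))
    simp_rw [e]
    rw [intervalIntegral.integral_add (((hc _).intervalIntegrable _ _).const_mul _)
      (((hc _).intervalIntegrable _ _).const_mul _), intervalIntegral.integral_const_mul,
      intervalIntegral.integral_const_mul, ih (by omega), ih (by omega)]
    ring

/-- `|∫_0^π cos^j(φ)cos(mφ)dφ| ≤ π`. [bookkeeping] -/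
theorem abs_integral_cos_pow_mul_cos_le (j : ℕ) (m : ℝ) :
    |∫ φ in (0 : ℝ)..π, Real.cos φ ^ j * Real.cos (m * φ)| ≤ π := by
  have h := intervalIntegral.norm_integral_le_of_norm_le_const (a := 0) (b := π) (C := 1)
    (f := fun φ => Real.cos φ ^ j * Real.cos (m * φ)) fun φ _ => by
      rw [norm_mul, norm_pow, Real.norm_eq_abs, Real.norm_eq_abs]
      exact mul_le_one₀ (pow_le_one₀ (abs_nonneg _) (Real.abs_cos_le_one _)) (abs_nonneg _)
        (Real.abs_cos_le_one _)
  rw [sub_zero, abs_of_pos Real.pi_pos, one_mul] at h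
  rwa [← Real.norm_eq_abs]

/-! ## §2 The arcsine laws `Λ_{m,s}` [folklore] -/

/-- Nonnegativity of the density `(1 + s cos(mφ))∕π` for `|s| ≤ 1`. [bookkeeping] -/
theorem density_nonneg {s : ℝ} (hs : |s| ≤ 1) (m : ℕ) (φ : ℝ) :
    0 ≤ (1 + s * Real.cos (m * φ)) / π := by
  refine div_nonneg ?_ Real.pi_pos.le
  have : |s * Real.cos (m * φ)| ≤ 1 := by
    rw [abs_mul]; exact mul_le_one₀ hs (abs_nonneg _) (Real.abs_cos_le_one _)
  linarith [neg_abs_le (s * Real.cos (m * φ))]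

/-- `(1∕π)∫_0^π (1 + s cos(mφ))dφ = 1` for `m ≥ 1`. [bookkeeping] -/
theorem integral_density_eq_one (s : ℝ) {m : ℕ} (hm : 1 ≤ m) :
    ∫ φ in (0 : ℝ)..π, (1 + s * Real.cos (m * φ)) / π = 1 := by
  have h0 : ∫ φ in (0 : ℝ)..π, Real.cos (m * φ) = 0 := by
    have := integral_cos_pow_mul_cos_eq_zero (j := 0) (m := m) (by omega)
    simpa using this
  have hc : Continuous fun φ : ℝ => Real.cos (m * φ) := Real.continuous_cos.comp (continuous_const.mul continuous_id)
  simp_rw [add_div, mul_div_assoc]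
  rw [intervalIntegral.integral_add (by exact intervalIntegrable_const) ((hc.intervalIntegrable _ _).div_const _ |>.const_mul _),
    intervalIntegral.integral_const, intervalIntegral.integral_const_mul, intervalIntegral.integral_div, h0]
  simp [Real.pi_ne_zero]

/-- ★ **THE ARCSINE LAWS.**  For every level `m ≥ 1` and amplitude `|s| ≤ 1` there is a probability law
`Λ_{m,s}` on `[−1,1]` (indeed on `[−½,½]`) — the law of `cos φ∕2` under the density `(1 + s cos(mφ))∕π`
on `[0,π]` — integrating every continuous `G` to `(1∕π)∫_0^π G(cos φ∕2)(1 + s cos(mφ))dφ`. [folklore] -/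
theorem exists_arcsineLaws :
    ∃ Λ : ℕ → ℝ → Measure ℝ,
      (∀ (m : ℕ) (s : ℝ), 1 ≤ m → |s| ≤ 1 → IsProbabilityMeasure (Λ m s)) ∧
      (∀ (m : ℕ) (s : ℝ), Λ m s (Set.Icc (-1 : ℝ) 1)ᶜ = 0) ∧
      (∀ (m : ℕ) (s : ℝ) (G : ℝ → ℝ), |s| ≤ 1 → Continuous G →
        ∫ x, G x ∂(Λ m s) = (1 / π) * ∫ φ in (0 : ℝ)..π, G (Real.cos φ / 2) * (1 + s * Real.cos (m * φ))) := by
  -- the density on `[0,π]`, as an `ℝ≥0`-valued function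
  set ρ : ℕ → ℝ → ℝ → NNReal := fun m s φ => Real.toNNReal ((1 + s * Real.cos (m * φ)) / π) with hρ
  have hρm : ∀ m s, Measurable (ρ m s) := fun m s =>
    ((measurable_const.add (measurable_const.mul (Real.measurable_cos.comp
      (measurable_const.mul measurable_id)))).div_const _).real_toNNReal
  set μ : ℕ → ℝ → Measure ℝ := fun m s =>
    ((volume : Measure ℝ).restrict (Set.Ioc 0 π)).withDensity fun φ => (ρ m s φ : ENNReal) with hμ
  have hmeas : Measurable fun φ : ℝ => Real.cos φ / 2 := Real.measurable_cos.div_const _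
  set Λ : ℕ → ℝ → Measure ℝ := fun m s => (μ m s).map fun φ => Real.cos φ / 2 with hΛ
  -- integrals against `μ m s` are interval integrals with the density
  have hint : ∀ (m : ℕ) (s : ℝ) (F : ℝ → ℝ), |s| ≤ 1 → Continuous F →
      ∫ φ, F φ ∂(μ m s) = ∫ φ in (0 : ℝ)..π, (1 + s * Real.cos (m * φ)) / π * F φ := by
    intro m s F hs hF
    simp only [hμ]
    rw [integral_withDensity_eq_integral_smul (hρm m s), intervalIntegral.integral_of_le Real.pi_pos.le]
    refine setIntegral_congr_fun measurableSet_Ioc fun φ _ => ?_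
    simp only [hρ, NNReal.smul_def, smul_eq_mul, Real.coe_toNNReal _ (density_nonneg hs m φ)]
  refine ⟨Λ, fun m s hm hs => ?_, fun m s => ?_, fun m s G hs hG => ?_⟩
  · -- probability
    have hμ1 : IsProbabilityMeasure (μ m s) := by
      constructor
      simp only [hμ]
      rw [withDensity_apply _ MeasurableSet.univ, Measure.restrict_univ,
        lintegral_coe_eq_integral _ ?_]
      · have h1 := hint m s (fun _ => 1) hs continuous_const
        rw [hμ] at h1
        simp only [mul_one] at h1
        have h2 : ∫ φ in Set.Ioc 0 π, ((ρ m s φ : NNReal) : ℝ) = ∫ φ in (0 : ℝ)..π, (1 + s * Real.cos (m * φ)) / π := by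
          rw [intervalIntegral.integral_of_le Real.pi_pos.le]
          refine setIntegral_congr_fun measurableSet_Ioc fun φ _ => ?_
          simp only [hρ, Real.coe_toNNReal _ (density_nonneg hs m φ)]
        rw [h2, integral_density_eq_one s hm, ENNReal.ofReal_one]
      · refine Measure.integrableOn_of_bounded (M := 2 / π) measure_Ioc_lt_top.ne
          (NNReal.continuous_coe.measurable.comp (hρm m s)).aestronglyMeasurable
          (Filter.Eventually.of_forall fun φ => ?_)
        simp only [hρ, Real.norm_eq_abs, Real.coe_toNNReal _ (density_nonneg hs m φ)]
        rw [abs_div, abs_of_pos Real.pi_pos, div_le_div_iff_of_pos_right Real.pi_pos]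
        have : |s * Real.cos (m * φ)| ≤ 1 := by
          rw [abs_mul]; exact mul_le_one₀ hs (abs_nonneg _) (Real.abs_cos_le_one _)
        rw [abs_le]
        constructor <;> linarith [le_abs_self (s * Real.cos (m * φ)), neg_abs_le (s * Real.cos (m * φ))]
    simp only [hΛ]
    exact Measure.isProbabilityMeasure_map hmeas.aemeasurable
  · -- support
    simp only [hΛ]
    rw [Measure.map_apply hmeas (measurableSet_Icc.compl)]
    have : (fun φ : ℝ => Real.cos φ / 2) ⁻¹' (Set.Icc (-1 : ℝ) 1)ᶜ = ∅ := by
      ext φ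
      simp only [Set.mem_preimage, Set.mem_compl_iff, Set.mem_Icc, Set.mem_empty_iff_false, iff_false,
        not_not]
      exact ⟨by linarith [Real.neg_one_le_cos φ], by linarith [Real.cos_le_one φ]⟩
    rw [this, measure_empty]
  · -- integral formula
    simp only [hΛ]
    rw [integral_map hmeas.aemeasurable hG.aestronglyMeasurable,
      hint m s (fun φ => G (Real.cos φ / 2)) hs (hG.comp (Real.continuous_cos.div_const _)),
      ← intervalIntegral.integral_const_mul]
    refine intervalIntegral.integral_congr fun φ _ => ?_
    field_simp

/-- ★ THE PAYMENT OF A CONTINUOUS OBSERVABLE: `∫G dΛ_{m,s} − ∫G dΛ_{m,0} = (s∕π)∫_0^π G(cos φ∕2)cos(mφ)dφ`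
(for any family with the integral formula of `exists_arcsineLaws`). [folklore] -/
theorem integral_sub_eq {Λ : ℕ → ℝ → Measure ℝ}
    (hΛ : ∀ (m : ℕ) (s : ℝ) (G : ℝ → ℝ), |s| ≤ 1 → Continuous G →
      ∫ x, G x ∂(Λ m s) = (1 / π) * ∫ φ in (0 : ℝ)..π, G (Real.cos φ / 2) * (1 + s * Real.cos (m * φ)))
    (m : ℕ) {s : ℝ} (hs : |s| ≤ 1) {G : ℝ → ℝ} (hG : Continuous G) :
    ∫ x, G x ∂(Λ m s) - ∫ x, G x ∂(Λ m 0) = (s / π) * ∫ φ in (0 : ℝ)..π, G (Real.cos φ / 2) * Real.cos (m * φ) := by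
  have hc1 : Continuous fun φ : ℝ => G (Real.cos φ / 2) := hG.comp (Real.continuous_cos.div_const _)
  have hc2 : Continuous fun φ : ℝ => Real.cos ((m : ℝ) * φ) := Real.continuous_cos.comp (continuous_const.mul continuous_id)
  have hi : ∀ s' : ℝ, IntervalIntegrable (fun φ : ℝ => G (Real.cos φ / 2) * (1 + s' * Real.cos (m * φ))) volume 0 π :=
    fun s' => Continuous.intervalIntegrable (by fun_prop) _ _
  rw [hΛ m s G hs hG, hΛ m 0 G (by simp) hG, ← mul_sub, ← intervalIntegral.integral_sub (hi s) (hi 0)]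
  have : ∀ φ : ℝ, G (Real.cos φ / 2) * (1 + s * Real.cos (m * φ)) - G (Real.cos φ / 2) * (1 + 0 * Real.cos (m * φ)) =
      s * (G (Real.cos φ / 2) * Real.cos (m * φ)) := fun φ => by ring
  simp_rw [this, intervalIntegral.integral_const_mul]
  field_simp

/-- ★ **UNIFORM MONOMIAL CLOSENESS BY EXACT ORTHOGONALITY.**  For `m ≥ 1`, `|s| ≤ 1` and EVERY order `j`:
`|∫x^j dΛ_{m,s} − ∫x^j dΛ_{m,0}| ≤ |s|·(½)^max(j,m) ≤ |s|·(½)^m` — the moments below the level do not move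
at all, the others carry the factor `(½)^j` of the half-scale support. [folklore] -/
theorem abs_moment_sub_le {Λ : ℕ → ℝ → Measure ℝ}
    (hΛ : ∀ (m : ℕ) (s : ℝ) (G : ℝ → ℝ), |s| ≤ 1 → Continuous G →
      ∫ x, G x ∂(Λ m s) = (1 / π) * ∫ φ in (0 : ℝ)..π, G (Real.cos φ / 2) * (1 + s * Real.cos (m * φ)))
    (m : ℕ) {s : ℝ} (hs : |s| ≤ 1) (j : ℕ) :
    |∫ x, x ^ j ∂(Λ m s) - ∫ x, x ^ j ∂(Λ m 0)| ≤ |s| * (1 / 2 : ℝ) ^ max j m ∧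
    |∫ x, x ^ j ∂(Λ m s) - ∫ x, x ^ j ∂(Λ m 0)| ≤ |s| * (1 / 2 : ℝ) ^ m := by
  have hid : ∫ x, x ^ j ∂(Λ m s) - ∫ x, x ^ j ∂(Λ m 0) =
      (s / π) * (1 / 2 : ℝ) ^ j * ∫ φ in (0 : ℝ)..π, Real.cos φ ^ j * Real.cos (m * φ) := by
    rw [integral_sub_eq hΛ m hs (continuous_pow j), mul_assoc]
    congr 1
    rw [← intervalIntegral.integral_const_mul]
    refine intervalIntegral.integral_congr fun φ _ => ?_
    simp only [div_pow]; ring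
  have h1 : |∫ x, x ^ j ∂(Λ m s) - ∫ x, x ^ j ∂(Λ m 0)| ≤ |s| * (1 / 2 : ℝ) ^ max j m := by
    rw [hid]
    rcases lt_or_ge j m with hjm | hjm
    · rw [integral_cos_pow_mul_cos_eq_zero hjm, mul_zero, abs_zero]; positivity
    · rw [max_eq_left hjm, abs_mul, abs_mul, abs_div, abs_of_pos Real.pi_pos,
        abs_of_pos (by positivity : (0 : ℝ) < (1 / 2) ^ j)]
      have := abs_integral_cos_pow_mul_cos_le j m
      calc |s| / π * (1 / 2 : ℝ) ^ j * |∫ φ in (0 : ℝ)..π, Real.cos φ ^ j * Real.cos (m * φ)|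
          ≤ |s| / π * (1 / 2 : ℝ) ^ j * π := mul_le_mul_of_nonneg_left this (by positivity)
        _ = |s| * (1 / 2 : ℝ) ^ j := by field_simp
  refine ⟨h1, h1.trans (mul_le_mul_of_nonneg_left ?_ (abs_nonneg _))⟩
  exact pow_le_pow_of_le_one (by norm_num) (by norm_num) (le_max_right j m)

/-! ## §3 The observable `G_f(x) = ∫_0^x f(arccos 2y)dy` and its exact payment [folklore] -/

/-- `G_f` has derivative `f(arccos 2x)` everywhere (`f` continuous). [bookkeeping] -/
theorem hasDerivAt_obsOf {f : ℝ → ℝ} (hf : Continuous f) (x : ℝ) :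
    HasDerivAt (fun u => ∫ y in (0 : ℝ)..u, f (Real.arccos (2 * y))) (f (Real.arccos (2 * x))) x := by
  have hc : Continuous fun y : ℝ => f (Real.arccos (2 * y)) :=
    hf.comp (Real.continuous_arccos.comp (continuous_const.mul continuous_id))
  exact intervalIntegral.integral_hasDerivAt_right (hc.intervalIntegrable _ _)
    (hc.stronglyMeasurableAtFilter _ _) hc.continuousAt

/-- `G_f` is continuously differentiable with `G_f′ = f(arccos 2·)`. [bookkeeping] -/
theorem contDiff_obsOf {f : ℝ → ℝ} (hf : Continuous f) :
    ContDiff ℝ 1 (fun u => ∫ y in (0 : ℝ)..u, f (Real.arccos (2 * y))) ∧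
    deriv (fun u => ∫ y in (0 : ℝ)..u, f (Real.arccos (2 * y))) = fun x => f (Real.arccos (2 * x)) := by
  have hd : deriv (fun u => ∫ y in (0 : ℝ)..u, f (Real.arccos (2 * y))) = fun x => f (Real.arccos (2 * x)) :=
    funext fun x => (hasDerivAt_obsOf hf x).deriv
  refine ⟨contDiff_one_iff_deriv.2 ⟨fun x => (hasDerivAt_obsOf hf x).differentiableAt, ?_⟩, hd⟩
  rw [hd]
  exact hf.comp (Real.continuous_arccos.comp (continuous_const.mul continuous_id))

/-- `G_f` is `B`-Lipschitz and `|G_f(x)| ≤ B|x|` when `|f| ≤ B`. [bookkeeping] -/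
theorem abs_obsOf_sub_le {f : ℝ → ℝ} (hf : Continuous f) {B : ℝ} (hB : ∀ φ, |f φ| ≤ B) (x y : ℝ) :
    |(∫ t in (0 : ℝ)..x, f (Real.arccos (2 * t))) - ∫ t in (0 : ℝ)..y, f (Real.arccos (2 * t))| ≤ B * |x - y| ∧
    |∫ t in (0 : ℝ)..x, f (Real.arccos (2 * t))| ≤ B * |x| := by
  have hc : Continuous fun y : ℝ => f (Real.arccos (2 * y)) :=
    hf.comp (Real.continuous_arccos.comp (continuous_const.mul continuous_id))
  have key : ∀ a b : ℝ, |∫ t in a..b, f (Real.arccos (2 * t))| ≤ B * |b - a| := fun a b => by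
    have h := intervalIntegral.norm_integral_le_of_norm_le_const (a := a) (b := b) (C := B)
      (f := fun t => f (Real.arccos (2 * t))) fun t _ => by rw [Real.norm_eq_abs]; exact hB _
    rwa [Real.norm_eq_abs] at h
  constructor
  · rw [intervalIntegral.integral_interval_sub_left (hc.intervalIntegrable 0 x) (hc.intervalIntegrable 0 y)]
    exact key y x
  · simpa using key 0 x

/-- ★ **THE EXACT PAYMENT OF `G_f` AT LEVEL `m+1`.**  For continuous `f`,
`∫_0^π G_f(cos φ∕2)·cos((m+1)φ)dφ = (∫_0^π f cos(m·) − ∫_0^π f cos((m+2)·))∕(4(m+1))`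
(integration by parts: `(G_f(cos φ∕2))′ = −f(φ) sin φ∕2` on `[0,π]`, then
`2 sin((m+1)φ) sin φ = cos(mφ) − cos((m+2)φ)`). [folklore] -/
theorem integral_obsOf_comp_mul_cos {f : ℝ → ℝ} (hf : Continuous f) (m : ℕ) :
    ∫ φ in (0 : ℝ)..π, (∫ y in (0 : ℝ)..(Real.cos φ / 2), f (Real.arccos (2 * y))) * Real.cos ((m + 1 : ℝ) * φ) =
      ((∫ φ in (0 : ℝ)..π, f φ * Real.cos (m * φ)) - ∫ φ in (0 : ℝ)..π, f φ * Real.cos ((m + 2 : ℝ) * φ)) /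
        (4 * (m + 1)) := by
  have hm : (m + 1 : ℝ) ≠ 0 := by positivity
  have hg : Continuous fun y : ℝ => f (Real.arccos (2 * y)) :=
    hf.comp (Real.continuous_arccos.comp (continuous_const.mul continuous_id))
  -- u = G_f(cos φ∕2), u' = f(arccos(cos φ))·(−sin φ∕2); v = sin((m+1)φ)∕(m+1), v' = cos((m+1)φ)
  have hu : ∀ φ ∈ Set.uIcc (0 : ℝ) π, HasDerivAt (fun φ => ∫ y in (0 : ℝ)..(Real.cos φ / 2), f (Real.arccos (2 * y)))
      (f (Real.arccos (2 * (Real.cos φ / 2))) * (-Real.sin φ / 2)) φ := fun φ _ => by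
    have h1 := hasDerivAt_obsOf hf (Real.cos φ / 2)
    have h2 : HasDerivAt (fun φ : ℝ => Real.cos φ / 2) (-Real.sin φ / 2) φ := (Real.hasDerivAt_cos φ).div_const 2
    exact h1.comp φ h2
  have hv : ∀ φ ∈ Set.uIcc (0 : ℝ) π, HasDerivAt (fun φ => Real.sin ((m + 1 : ℝ) * φ) / (m + 1))
      (Real.cos ((m + 1 : ℝ) * φ)) φ := fun φ _ => by
    have h1 : HasDerivAt (fun φ : ℝ => (m + 1 : ℝ) * φ) (m + 1 : ℝ) φ := by
      simpa using (hasDerivAt_id φ).const_mul (m + 1 : ℝ)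
    exact (h1.sin.div_const (m + 1 : ℝ)).congr_deriv (by field_simp)
  have hu' : Continuous fun φ => f (Real.arccos (2 * (Real.cos φ / 2))) * (-Real.sin φ / 2) :=
    (hg.comp (Real.continuous_cos.div_const _)).mul ((Real.continuous_sin.neg).div_const _)
  have hv' : Continuous fun φ => Real.cos ((m + 1 : ℝ) * φ) := Real.continuous_cos.comp (continuous_const.mul continuous_id)
  have ibp := intervalIntegral.integral_mul_deriv_eq_deriv_mul hu hv (hu'.intervalIntegrable _ _) (hv'.intervalIntegrable _ _)
  rw [ibp]
  -- boundary terms vanish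
  have hb1 : Real.sin ((m + 1 : ℝ) * π) = 0 := by exact_mod_cast Real.sin_nat_mul_pi (m + 1)
  simp only [hb1, mul_zero, Real.sin_zero, zero_div, sub_zero, zero_sub]
  -- simplify the integrand on `[0,π]`: `arccos(cos φ) = φ` and the product formula
  have hI : ∫ φ in (0 : ℝ)..π, f (Real.arccos (2 * (Real.cos φ / 2))) * (-Real.sin φ / 2) * (Real.sin ((m + 1 : ℝ) * φ) / (m + 1)) =
      ∫ φ in (0 : ℝ)..π, -(1 / (4 * (m + 1))) * (f φ * Real.cos (m * φ) - f φ * Real.cos ((m + 2 : ℝ) * φ)) := by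
    refine intervalIntegral.integral_congr fun φ hφ => ?_
    rw [Set.uIcc_of_le Real.pi_pos.le] at hφ
    rw [show 2 * (Real.cos φ / 2) = Real.cos φ by ring, Real.arccos_cos hφ.1 hφ.2]
    have h2 := Real.two_mul_sin_mul_sin ((m + 1 : ℝ) * φ) φ
    rw [show (m + 1 : ℝ) * φ - φ = m * φ by ring, show (m + 1 : ℝ) * φ + φ = (m + 2 : ℝ) * φ by ring] at h2
    rw [← mul_sub, ← h2]
    field_simp
    ring
  have i1 : IntervalIntegrable (fun φ : ℝ => f φ * Real.cos (m * φ)) volume 0 π :=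
    Continuous.intervalIntegrable (by fun_prop) _ _
  have i2 : IntervalIntegrable (fun φ : ℝ => f φ * Real.cos ((m + 2 : ℝ) * φ)) volume 0 π :=
    Continuous.intervalIntegrable (by fun_prop) _ _
  rw [hI, intervalIntegral.integral_const_mul, intervalIntegral.integral_sub i1 i2]
  field_simp

end Summit.QuantumFields.YangMills.Theorems.BalabanUVNodesN19ArcsineRoad
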